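import Mathlib
import HarnessLib
import Summits.Parity.GeneralizedHardyLittlewood.Theorems.TypeIILiouville.Negative.TypeIILiouvilleLoadBearing

/-!
# `TypeIILiouville` (stmt-Parity-13322): the crux bounds the dilation variance — refutation template

Negative-side lemma (disprover's record, cycle 1, part 3) for the crux `LiouvilleMAD.TypeIILiouville`,
in the notation of `TypeIILiouvilleLoadBearing` (`TypeIIShape`, `lam`).

Testing the crux against `β = 1` and the adversarial row sums `α_m = Σ_{n∼N} λ(mn+c)` gives
`dilationVariance_le_of_typeIIShape`:
`V_c(M,N) := Σ_{m∼M} (Σ_{n∼N} λ(mn+c))² ≤ C² M N² (N^{-1/2} + M^{-η})²` for all `1 ≤ N ≤ M`, i.e.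
square-root cancellation in mean square over `m` of `λ` along the dilation progressions
`{mn+c}_{n∼N}` once `N ≤ M^{2η}` (random value `V ≍ MN`; kit numerics of IdeatorMemo1 §2:
`V/(MN) ∈ [0.94, 1.07]` for `M = 2048`, `N ≤ 512`, `c ∈ {1,-1,2}`). Contrapositive
(`typeIILiouville_false_of_dilationVariance_large`): a family of boxes at ONE shift `c ≠ 0` with
`V_c(M,N) > C² M N² (N^{-1/2}+M^{-η})²` for every `η > 0`, `C` — e.g. `V ≥ M N^{1+κ}` with
`N ≤ M^{o(1)}` — refutes the crux. This is the cheapest Ω-target for future disprovers; no such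
family is known or expected (it would exhibit power-scale bias of `λ` in progressions). [folklore]
-/

namespace Summit.Parity.GeneralizedHardyLittlewood.Theorems.TypeIILiouville.Negative

open Finset Filter
open Summit.Parity.GeneralizedHardyLittlewood.Theses.LiouvilleMAD

/-- The `m`-averaged variance of `λ` along the dilation progressions `{mn+c : n ∈ (N,2N]}`. -/
def dilationVariance (c : ℤ) (M N : ℕ) : ℝ :=
  ∑ m ∈ Ioc M (2 * M), (∑ n ∈ Ioc N (2 * N), lam (Int.toNat ((m : ℤ) * n + c))) ^ 2

/-- The crux's shape at shift `c` bounds the dilation variance: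
`V_c(M,N) ≤ C² M N² (N^{-1/2} + M^{-η})²` for all `1 ≤ N ≤ M`. -/
theorem dilationVariance_le_of_typeIIShape {c : ℤ} (h : TypeIIShape lam c) :
    ∃ η : ℝ, 0 < η ∧ ∃ C : ℝ, ∀ M N : ℕ, 1 ≤ N → N ≤ M →
      dilationVariance c M N ≤
        C ^ 2 * M * N ^ 2 * ((N : ℝ) ^ (-(1 / 2 : ℝ)) + (M : ℝ) ^ (-η)) ^ 2 := by
  obtain ⟨η, hη, C, h⟩ := h
  refine ⟨η, hη, C, fun M N hN hNM => ?_⟩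
  have hbox := h M N hN hNM (fun m => ∑ n ∈ Ioc N (2 * N), lam (Int.toNat ((m : ℤ) * n + c)))
    (fun _ => 1)
  beta_reduce at hbox
  have hL : ∑ m ∈ Ioc M (2 * M), ∑ n ∈ Ioc N (2 * N),
      (∑ n ∈ Ioc N (2 * N), lam (Int.toNat ((m : ℤ) * n + c))) * 1 *
        lam (Int.toNat ((m : ℤ) * n + c)) = dilationVariance c M N := by
    unfold dilationVariance
    refine sum_congr rfl fun m _ => ?_
    rw [sq, mul_sum]
    exact sum_congr rfl fun n _ => by ring
  have hA : ∑ m ∈ Ioc M (2 * M), (∑ n ∈ Ioc N (2 * N), lam (Int.toNat ((m : ℤ) * n + c))) ^ 2 =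
      dilationVariance c M N := rfl
  have hβ : ∑ n ∈ Ioc N (2 * N), (1 : ℝ) ^ 2 = N := by
    simp only [one_pow, sum_const, card_Ioc_two_mul, nsmul_eq_mul, mul_one]
  rw [hL, hA, hβ] at hbox
  set V := dilationVariance c M N with hVdef
  set X := (N : ℝ) ^ (-(1 / 2 : ℝ)) + (M : ℝ) ^ (-η) with hXdef
  have hV0 : 0 ≤ V := sum_nonneg fun _ _ => sq_nonneg _
  rw [abs_of_nonneg hV0] at hbox
  rcases hV0.eq_or_lt with hV | hV
  · rw [← hV]; positivity
  · have hs : 0 < Real.sqrt V := Real.sqrt_pos.mpr hV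
    have hle : Real.sqrt V ≤ C * (Real.sqrt N * Real.sqrt ((M : ℝ) * N) * X) := by
      refine le_of_mul_le_mul_left ?_ hs
      calc Real.sqrt V * Real.sqrt V = V := Real.mul_self_sqrt hV0
        _ ≤ C * Real.sqrt V * Real.sqrt N * Real.sqrt ((M : ℝ) * N) * X := hbox
        _ = Real.sqrt V * (C * (Real.sqrt N * Real.sqrt ((M : ℝ) * N) * X)) := by ring
    calc V = Real.sqrt V ^ 2 := (Real.sq_sqrt hV0).symm
      _ ≤ (C * (Real.sqrt N * Real.sqrt ((M : ℝ) * N) * X)) ^ 2 := pow_le_pow_left₀ hs.le hle 2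
      _ = C ^ 2 * M * N ^ 2 * X ^ 2 := by
          rw [mul_pow, mul_pow, mul_pow, Real.sq_sqrt (by positivity), Real.sq_sqrt (by positivity)]
          ring

/-- REFUTATION TEMPLATE: a power failure of square-root cancellation in the dilation variance at
ONE shift `c ≠ 0` — boxes `1 ≤ N ≤ M` with `V_c(M,N) > C² M N² (N^{-1/2} + M^{-η})²` for every
`η > 0` and `C` — refutes the crux. -/
theorem typeIILiouville_false_of_dilationVariance_large {c : ℤ} (hc : c ≠ 0)
    (hV : ∀ η : ℝ, 0 < η → ∀ C : ℝ, ∃ M N : ℕ, 1 ≤ N ∧ N ≤ M ∧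
      C ^ 2 * M * N ^ 2 * ((N : ℝ) ^ (-(1 / 2 : ℝ)) + (M : ℝ) ^ (-η)) ^ 2 < dilationVariance c M N) :
    ¬ TypeIILiouville := by
  intro h
  obtain ⟨η, hη, C, hb⟩ := dilationVariance_le_of_typeIIShape (h c hc)
  obtain ⟨M, N, hN, hNM, hlt⟩ := hV η hη C
  exact absurd hlt (not_lt.mpr (hb M N hN hNM))

end Summit.Parity.GeneralizedHardyLittlewood.Theorems.TypeIILiouville.Negative
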